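import Mathlib
import Summits.PneNP.PneNP.Theses.OverlapGapAlgebra
import Summits.PneNP.PneNP.Theorems.OverlapGapAlgebraSearchHardWindowMacroNoStableSection
import Summits.PneNP.PneNP.Theorems.OverlapGapAlgebraSearchHardWindowBlockPaths
import Summits.PneNP.PneNP.Theorems.OverlapGapAlgebraSearchHardWindowVanishingLowDegreeAux
import Summits.PneNP.PneNP.Theorems.OverlapGapAlgebraSearchHardWindowSmoothMapsFail
import Literature.Computability.Complexity.RandomKSatLowDegreeHardness

/-!
# Route OverlapGapAlgebra, crux `SearchHardWindow` (stmt-PneNP-2460): vanishing low-degree success,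
# SIGN-ROBUST form — a linear number of output coordinates may be wrong in ANY way

`vanishingLowDegreeRobust` (`…VanishingRobust.lean`) allows `≤ η₀ n` UNSATURATED coordinates but asks
the sign rounding `sgn F(Φ)` itself to satisfy `Φ`. Class rungs obtained by Fourier TRUNCATION with
only moderately small tails (de Morgan formulas via shrinkage, `…FormulaRung.lean`) need more: the
truncated surrogate of a Boolean map may be unsaturated OR wrongly signed on a small input-dependent
set of coordinates. The event bounded here is therefore `E(Φ)`: some assignment `σ` satisfying `Φ`
has `#{v : |F(Φ)_v| < 1 ∨ σ_v ≠ sgn F(Φ)_v} ≤ η₀ n`.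

**Theorem (`vanishingLowDegreeRobustSign`).** For `k ≥ k₀` there is `η₀ > 0` such that for every
`C > 0`, `D_n = o(n/log² n)`, `ε > 0`, eventually in `n`, EVERY `F : instances → ℝⁿ` of coordinate
degree `≤ D_n` and energy `≤ C n · #Inst` has `#{Φ : E(Φ)} ≤ ε · #Inst`.
Proof: that of `vanishingLowDegreeRobust` (macro `NoStableSection` with checkpoints every `L`
literals + the block scan correlation inequality) run with the SECTION `g(Φ) :=` a witness `σ` of
`E(Φ)` when one exists (else `sgn F(Φ)`): at checkpoints in the event `g` is fully valid, and between
consecutive checkpoints `d_H(g Φ, g Φ') ≤ d_H(σ, sgn FΦ) + d_H(sgn FΦ, sgn FΦ') + d_H(sgn FΦ', σ')`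
`≤ 2η₀ n + (η₀ n + ‖FΦ − FΦ'‖²)` (`vlr_hammingDist_le`); with `η₀ = η/6` and `L²`-threshold `η/2`
the section is `ηn`-stable. No new definitions; axioms standard.
References: G. Bresler, B. Huang, arXiv:2106.02129, Def. 2.4, Thm. 2.6 [BreslerHuang2022];
B. Huang, M. Sellke, arXiv:2501.06427, Cor. 3.21 [HuangSellke2025].
-/

namespace Summit.PneNP.PneNP.Theorems

set_option linter.dupNamespace false -- `Summit.PneNP.PneNP.…`: summit = sub-problem (D-0017)

open Finset Filter Asymptotics
open Summit.PneNP.PneNP.Theses.OverlapGapAlgebra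
open Literature.Computability.Complexity (IsCoordDegreeLE)
open Literature.Probability.Moments
open scoped Classical

/-- **Vanishing low-degree success, sign-robust form (unconditional, threshold uniform in the map):**
for `k ≥ k₀` there is `η₀ > 0` such that for all `C > 0`, `D_n = o(n/log² n)`, `ε > 0`, eventually in
`n`, every map `F` of coordinate degree `≤ D_n` and energy `≤ C n · #Inst` admits, on at most
`ε · #Inst` instances `Φ`, a satisfying assignment `σ` of `Φ` with
`#{v : |F(Φ)_v| < 1 ∨ σ_v ≠ sgn F(Φ)_v} ≤ η₀ n`. [BreslerHuang2022, Thm. 2.6; HuangSellke2025, Cor. 3.21] -/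
theorem vanishingLowDegreeRobustSign :
    ∃ k₀ : ℕ, ∀ k : ℕ, k₀ ≤ k → ∃ η₀ : ℝ, 0 < η₀ ∧ ∀ C : ℝ, 0 < C → ∀ D : ℕ → ℕ,
      (fun n : ℕ => (D n : ℝ)) =o[atTop] (fun n : ℕ => (n : ℝ) / Real.log n ^ 2) →
      ∀ ε : ℝ, 0 < ε → ∀ᶠ n : ℕ in atTop, ∀ m : ℕ, m = ⌊5 * 2 ^ k * Real.log k / k * n⌋₊ →
        ∀ F : (Fin m → Fin k → Fin n × Bool) → Fin n → ℝ,
          (∀ v : Fin n, IsCoordDegreeLE (D n)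
            (fun y : Fin m × Fin k → Fin n × Bool => F (Function.curry y) v)) →
          ∑ Φ : Fin m → Fin k → Fin n × Bool, ∑ v : Fin n, F Φ v ^ 2
              ≤ C * n * Fintype.card (Fin m → Fin k → Fin n × Bool) →
          ((univ.filter fun Φ : Fin m → Fin k → Fin n × Bool =>
              ∃ σ : Fin n → Bool, (∀ i : Fin m, ∃ j : Fin k, σ (Φ i j).1 = (Φ i j).2) ∧
                ((univ.filter fun v : Fin n =>
                    |F Φ v| < 1 ∨ σ v ≠ decide (0 ≤ F Φ v)).card : ℝ) ≤ η₀ * n).card : ℝ)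
            ≤ ε * Fintype.card (Fin m → Fin k → Fin n × Bool) := by
  obtain ⟨k₀, hk₀⟩ := macroNoStableSection
  refine ⟨max k₀ 3, fun k hk => ?_⟩
  have hk0 : k₀ ≤ k := le_trans (le_max_left _ _) hk
  have hk3 : 3 ≤ k := le_trans (le_max_right _ _) hk
  obtain ⟨η, hη, ν, hν, c₀, hc₀, hev⟩ := hk₀ k hk0
  refine ⟨η / 6, by positivity, ?_⟩
  -- the `L²`-movement threshold between checkpoints
  set η₂ : ℝ := η / 2 with hη₂
  have hη₂0 : 0 < η₂ := by positivity
  have hα1 : (1 : ℝ) ≤ 5 * 2 ^ k * Real.log k / k := smoothMaps_one_le_density hk3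
  set α : ℝ := 5 * 2 ^ k * Real.log k / k with hα
  have hαpos : 0 < α := by linarith
  have hkpos : (0 : ℝ) < k := by exact_mod_cast (by omega : 0 < k)
  have hk1r : (1 : ℝ) ≤ k := by exact_mod_cast (by omega : 1 ≤ k)
  intro C hC D hD ε hε
  -- the trivial case `ε ≥ 1`
  by_cases hε1 : 1 ≤ ε
  · refine Filter.Eventually.of_forall fun n m _ F _ _ =>
      le_trans ?_ (le_mul_of_one_le_left (Nat.cast_nonneg _) hε1)
    exact_mod_cast Finset.card_le_univ _
  push Not at hε1
  -- the block length `L ≈ (8k²α/c₀) log(1/ε)` and the degree budget `θ`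
  set lε : ℝ := Real.log (1 / ε) with hlε
  have hlε0 : 0 < lε := Real.log_pos (by rw [lt_div_iff₀ hε]; linarith)
  set L : ℕ := ⌈8 * k ^ 2 * α * lε / c₀⌉₊ + 1 with hLdef
  have hL1 : 1 ≤ L := by rw [hLdef]; omega
  have hLr1 : (1 : ℝ) ≤ L := by exact_mod_cast hL1
  have hLrpos : (0 : ℝ) < L := by linarith
  have hLge : 8 * k ^ 2 * α * lε / c₀ ≤ L := by
    rw [hLdef]; push_cast
    linarith [Nat.le_ceil (8 * k ^ 2 * α * lε / c₀)]
  set θ : ℝ := (c₀ * ε / 64) ^ 2 * η₂ / (L * k ^ 3 * α * C) with hθ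
  have hθpos : 0 < θ := by positivity
  have hDev : ∀ᶠ n : ℕ in atTop, (D n : ℝ) ≤ θ * (n / Real.log n ^ 2) := by
    filter_upwards [hD.def hθpos, eventually_ge_atTop 2] with n hn hn2
    rw [Real.norm_natCast, Real.norm_of_nonneg (by positivity)] at hn
    exact hn
  -- `n` large: the constant term of the exponent and `L ≤ α n`
  have hbig : ∀ᶠ n : ℕ in atTop, ((k : ℝ) ^ 2 + 1) * lε ≤ c₀ * n / 4 ∧ (L : ℝ) ≤ α * n := by
    have h1 : Tendsto (fun n : ℕ => c₀ * n / 4) atTop atTop := by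
      have : Tendsto (fun n : ℕ => c₀ / 4 * n) atTop atTop :=
        Tendsto.const_mul_atTop (by positivity) tendsto_natCast_atTop_atTop
      refine this.congr fun n => by ring
    have h2 : Tendsto (fun n : ℕ => α * n) atTop atTop :=
      Tendsto.const_mul_atTop hαpos tendsto_natCast_atTop_atTop
    filter_upwards [h1.eventually_ge_atTop _, h2.eventually_ge_atTop _] with n hn1 hn2
    exact ⟨hn1, hn2⟩
  filter_upwards [hev, hDev, hbig, eventually_ge_atTop 2] with n hNSS hDn hbign hn2 m hm F hdeg hener
  obtain ⟨hconst, hLαn⟩ := hbign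
  -- positivity bookkeeping
  have hn1 : 1 ≤ n := by omega
  have hn1' : (1 : ℝ) ≤ n := by exact_mod_cast hn1
  have hn2' : (2 : ℝ) ≤ n := by exact_mod_cast hn2
  have hnpos : (0 : ℝ) < n := by linarith
  have hlog2 : 0 < Real.log 2 := Real.log_pos (by norm_num)
  have hlogn : Real.log 2 ≤ Real.log n := Real.log_le_log (by norm_num) hn2'
  have hlogpos : 0 < Real.log n := lt_of_lt_of_le hlog2 hlogn
  have hmle : (m : ℝ) ≤ α * n := by
    rw [hm, hα]; exact Nat.floor_le (by positivity)
  have hmn : n ≤ m := by rw [hm]; exact smoothMaps_le_numClauses hk3 n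
  haveI : Nonempty (Fin n × Bool) := ⟨(⟨0, hn1⟩, true)⟩
  set Q : ℝ := (Fintype.card (Fin m → Fin k → Fin n × Bool) : ℝ) with hQ
  have hQpos : 0 < Q := by rw [hQ]; exact_mod_cast Fintype.card_pos
  have hPpos : (0 : ℝ) < Fintype.card (Fin (k + 1) → Fin m → Fin k → Fin n × Bool) := by
    exact_mod_cast Fintype.card_pos
  -- suppose the success set `S` is large
  by_contra hcon
  rw [not_le] at hcon
  set S : Finset (Fin m → Fin k → Fin n × Bool) := univ.filter fun Φ : Fin m → Fin k → Fin n × Bool =>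
    ∃ σ : Fin n → Bool, (∀ i : Fin m, ∃ j : Fin k, σ (Φ i j).1 = (Φ i j).2) ∧
      ((univ.filter fun v : Fin n =>
          |F Φ v| < 1 ∨ σ v ≠ decide (0 ≤ F Φ v)).card : ℝ) ≤ η / 6 * n with hSdef
  have hSbig : ε * Q < S.card := hcon
  have hScard_pos : (0 : ℝ) < S.card := lt_trans (mul_pos hε hQpos) hSbig
  have hSne : S.Nonempty := Finset.card_pos.1 (by exact_mod_cast hScard_pos)
  -- the padding
  set m' : ℕ := (m + L - 1) / L with hm'
  have hmm' : m ≤ m' * L := by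
    rw [hm']
    have h := Nat.div_add_mod (m + L - 1) L
    have h2 : (m + L - 1) % L < L := Nat.mod_lt _ hL1
    have h3 : L * ((m + L - 1) / L) = (m + L - 1) / L * L := Nat.mul_comm _ _
    omega
  have hm'le : (m' : ℝ) ≤ m / L + 1 := by
    have h1 : ((m' : ℕ) : ℝ) * L ≤ m + L := by
      have : m' * L ≤ m + L - 1 := by rw [hm']; exact Nat.div_mul_le_self _ _
      have : ((m' * L : ℕ) : ℝ) ≤ ((m + L - 1 : ℕ) : ℝ) := by exact_mod_cast this
      have h4 : ((m + L - 1 : ℕ) : ℝ) ≤ (m : ℝ) + L := by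
        have : m + L - 1 ≤ m + L := Nat.sub_le _ _
        exact_mod_cast this
      push_cast at this
      linarith only [this, h4]
    rw [div_add_one hLrpos.ne', le_div_iff₀ hLrpos]
    exact h1
  obtain ⟨e, he⟩ := blk_padEquiv (Fin n × Bool) k m L m' hL1 hmm'
  -- the instability relation and its budget (on the padded space)
  set Far : (Fin m → Fin k → Fin n × Bool) → (Fin m → Fin k → Fin n × Bool) → Prop :=
    fun Φ Φ' => η₂ * n < ∑ v, (F Φ v - F Φ' v) ^ 2 with hFar
  have hsymm : ∀ Φ Φ', Far Φ Φ' → Far Φ' Φ := fun Φ Φ' h => by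
    simp only [hFar] at h ⊢
    calc η₂ * n < ∑ v, (F Φ v - F Φ' v) ^ 2 := h
      _ = ∑ v, (F Φ' v - F Φ v) ^ 2 := Finset.sum_congr rfl fun v _ => by ring
  have hirr : ∀ Φ, ¬ Far Φ Φ := fun Φ h => by
    simp only [hFar, sub_self] at h
    simp at h
    have : (0 : ℝ) < η₂ * n := by positivity
    linarith only [h, this]
  -- the padded map `F ∘ proj` and its block degree / energy
  set Fh : (Fin m' → Fin k → Fin L → Fin n × Bool) → Fin n → ℝ := fun Φh v => F (e Φh).1 v
    with hFh
  choose fa fc fo hidx _ho hfor using he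
  have hdegh : ∀ v, IsCoordDegreeLE (D n)
      (fun y : Fin m' × Fin k → (Fin L → Fin n × Bool) => Fh (Function.curry y) v) := by
    intro v
    have h := vld_degree_of_pullback (hdeg v) (fun ac : Fin m × Fin k => (fa ac.1 ac.2, fc ac.1 ac.2))
      (fun (y : Fin m' × Fin k → (Fin L → Fin n × Bool)) (ac : Fin m × Fin k) =>
        y (fa ac.1 ac.2, fc ac.1 ac.2) (fo ac.1 ac.2))
      (fun y y' ac hyy' => by simp only [hyy'])
    refine (congrArg (IsCoordDegreeLE (D n)) ?_).mp h
    funext y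
    simp only [hFh]
    congr 1
    funext a c
    rw [hfor a c]
    rfl
  have hJpos : (0 : ℝ) < Fintype.card (Fin (m' * k * L - m * k) → Fin n × Bool) := by
    exact_mod_cast Fintype.card_pos
  have henerh : ∑ Φh : Fin m' → Fin k → Fin L → Fin n × Bool, ∑ v, Fh Φh v ^ 2 =
      Fintype.card (Fin (m' * k * L - m * k) → Fin n × Bool) *
        ∑ Φ : Fin m → Fin k → Fin n × Bool, ∑ v, F Φ v ^ 2 := by
    simp only [hFh]
    rw [Fintype.sum_equiv e (fun Φh => ∑ v, F (e Φh).1 v ^ 2)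
      (fun p => ∑ v, F p.1 v ^ 2) (fun _ => rfl), Fintype.sum_prod_type]
    simp only [Finset.sum_const, Finset.card_univ, nsmul_eq_mul]
    rw [Finset.mul_sum]
  set B : ℝ := 2 * (D n) * (2 * n : ℝ) ^ L / (η₂ * n) *
    (Fintype.card (Fin (m' * k * L - m * k) → Fin n × Bool) * (C * n * Q)) with hB
  have hcSB : (Fintype.card (Fin L → Fin n × Bool) : ℝ) = (2 * n) ^ L := by
    rw [Fintype.card_fun, Fintype.card_prod, Fintype.card_fin, Fintype.card_bool, Fintype.card_fin]
    push_cast; ring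
  have hBbound : (∑ a' : Fin m', ∑ c' : Fin k,
      (((Finset.univ : Finset ((Fin m' → Fin k → Fin L → Fin n × Bool) × (Fin L → Fin n × Bool))).filter
        fun p => Far (e p.1).1
          (e (Function.update p.1 a' (Function.update (p.1 a') c' p.2))).1).card : ℝ)) ≤ B := by
    have h := vld_farCount_le hn1 hη₂0 Fh hdegh
    simp only [hFh] at h
    refine h.trans ?_
    rw [hB, hcSB, henerh]
    refine mul_le_mul_of_nonneg_left (mul_le_mul_of_nonneg_left hener hJpos.le) ?_
    positivity
  -- the block scan correlation inequality …
  have hscan := scanCorrelation_blockPaths k m n L m' hn1 hL1 e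
    (fun a c => ⟨fa a c, fc a c, fo a c, hidx a c, hfor a c⟩) S hSne Far hsymm hirr B hBbound
  -- … against the macro `NoStableSection` ceiling for the SECTION `g`: a satisfying assignment
  -- `η/6 · n`-close to the saturated sign pattern where one exists, else the sign pattern itself
  set g : (Fin m → Fin k → Fin n × Bool) → (Fin n → Bool) := fun Φ =>
    if h : ∃ σ : Fin n → Bool, (∀ i : Fin m, ∃ j : Fin k, σ (Φ i j).1 = (Φ i j).2) ∧
        ((univ.filter fun v : Fin n =>
            |F Φ v| < 1 ∨ σ v ≠ decide (0 ≤ F Φ v)).card : ℝ) ≤ η / 6 * n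
    then h.choose else fun v => decide (0 ≤ F Φ v) with hg
  have hgS : ∀ Φ ∈ S, (∀ i : Fin m, ∃ j : Fin k, g Φ (Φ i j).1 = (Φ i j).2) ∧
      ((univ.filter fun v : Fin n =>
          |F Φ v| < 1 ∨ g Φ v ≠ decide (0 ≤ F Φ v)).card : ℝ) ≤ η / 6 * n := by
    intro Φ hΦ
    simp only [hSdef, Finset.mem_filter, Finset.mem_univ, true_and] at hΦ
    have hgΦ : g Φ = hΦ.choose := by simp only [hg, dif_pos hΦ]
    rw [hgΦ]
    exact hΦ.choose_spec
  -- distance from the section to the sign pattern / unsaturated coordinates, at a point of `S`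
  have hgdist : ∀ Φ ∈ S, (hammingDist (g Φ) (fun v => decide (0 ≤ F Φ v)) : ℝ) ≤ η / 6 * n := by
    refine fun Φ hΦ => le_trans ?_ (hgS Φ hΦ).2
    rw [hammingDist]
    exact_mod_cast Finset.card_le_card fun v hv => by
      simp only [Finset.mem_filter, Finset.mem_univ, true_and] at hv ⊢; exact Or.inr hv
  have hunsat : ∀ Φ ∈ S, ((univ.filter fun v : Fin n => |F Φ v| < 1).card : ℝ) ≤ η / 6 * n := by
    refine fun Φ hΦ => le_trans ?_ (hgS Φ hΦ).2
    exact_mod_cast Finset.card_le_card fun v hv => by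
      simp only [Finset.mem_filter, Finset.mem_univ, true_and] at hv ⊢; exact Or.inl hv
  have hN := hNSS m hm L hL1 g
  have hsub : ((univ : Finset (Fin (k + 1) → Fin m → Fin k → Fin n × Bool)).filter fun Ψ =>
          (∀ r : Fin k, ∀ i ≤ m' * k,
            (fun (a : Fin m) (b : Fin k) =>
              if (a : ℕ) * k + b < i * L then Ψ r.succ a b else Ψ r.castSucc a b) ∈ S) ∧
          ∀ r : Fin k, ∀ i < m' * k,
            ¬ Far (fun (a : Fin m) (b : Fin k) =>
                if (a : ℕ) * k + b < i * L then Ψ r.succ a b else Ψ r.castSucc a b)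
              (fun (a : Fin m) (b : Fin k) =>
                if (a : ℕ) * k + b < (i + 1) * L then Ψ r.succ a b else Ψ r.castSucc a b)) ⊆
      ((Finset.univ.filter fun Ψ : Fin (k + 1) → Fin m → Fin k → Fin n × Bool =>
          let P : Fin k → ℕ → Fin m → Fin k → Fin n × Bool := fun r q a b =>
            if (a : ℕ) * k + b < q then Ψ r.succ a b else Ψ r.castSucc a b
          (∀ r : Fin k, ∀ i ≤ (m + L - 1) / L * k,
              ((Finset.univ.filter fun a : Fin m => ∀ j, g (P r (i * L)) (P r (i * L) a j).1 ≠
                (P r (i * L) a j).2).card : ℝ) ≤ ν * m) ∧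
            ∀ r : Fin k, ∀ i < (m + L - 1) / L * k,
              (hammingDist (g (P r (i * L))) (g (P r ((i + 1) * L))) : ℝ) ≤ η * n)) := by
    intro Ψ hΨ
    simp only [Finset.mem_filter, Finset.mem_univ, true_and] at hΨ ⊢
    obtain ⟨hval, hstab⟩ := hΨ
    constructor
    · intro r i hi
      set Φ₀ : Fin m → Fin k → Fin n × Bool := fun a b =>
        if (a : ℕ) * k + b < i * L then Ψ r.succ a b else Ψ r.castSucc a b with hΦ₀
      have hmem := hgS Φ₀ (hval r i hi)
      have hempty : (Finset.univ.filter fun a : Fin m => ∀ j,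
          g Φ₀ (Φ₀ a j).1 ≠ (Φ₀ a j).2) = ∅ :=
        Finset.filter_eq_empty_iff.2 fun a _ ha => by
          obtain ⟨j, hj⟩ := hmem.1 a
          exact ha j hj
      rw [hempty, Finset.card_empty, Nat.cast_zero]
      positivity
    · intro r i hi
      -- the two consecutive checkpoints `Φ₀ = P r (iL)`, `Φ₁ = P r ((i+1)L)`, both in `S`
      set Φ₀ : Fin m → Fin k → Fin n × Bool := fun a b =>
        if (a : ℕ) * k + b < i * L then Ψ r.succ a b else Ψ r.castSucc a b with hΦ₀
      set Φ₁ : Fin m → Fin k → Fin n × Bool := fun a b =>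
        if (a : ℕ) * k + b < (i + 1) * L then Ψ r.succ a b else Ψ r.castSucc a b with hΦ₁
      have hfar := hstab r i hi
      simp only [hFar, not_lt] at hfar
      have h0 := hgdist Φ₀ (hval r i hi.le)
      have h1 := hgdist Φ₁ (hval r (i + 1) (Nat.succ_le_of_lt hi))
      have hu := hunsat Φ₀ (hval r i hi.le)
      have hmid := vlr_hammingDist_le (F Φ₀) (F Φ₁)
      have htri1' := (Nat.cast_le (α := ℝ)).2
        (hammingDist_triangle (g Φ₀) (fun v => decide (0 ≤ F Φ₀ v)) (g Φ₁))
      have htri2' := (Nat.cast_le (α := ℝ)).2 (hammingDist_triangle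
        (fun v => decide (0 ≤ F Φ₀ v)) (fun v => decide (0 ≤ F Φ₁ v)) (g Φ₁))
      rw [hammingDist_comm] at h1
      push_cast at htri1' htri2'
      have h3 : η / 6 * n + (η / 6 * n + η₂ * n) + η / 6 * n = η * n := by rw [hη₂]; ring
      linarith [hmid, h0, h1, hu, hfar, htri1', htri2', h3]
  have hcard := Finset.card_le_card hsub
  have hchain : (Fintype.card (Fin (k + 1) → Fin m → Fin k → Fin n × Bool) : ℝ) *
      ((S.card : ℝ) / Q) ^ (k * (m' * k) + 1) *
      Real.exp (-(2 * Real.log (2 * (2 * n : ℝ) ^ L) /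
          (S.card * (2 * n : ℝ) ^ (m' * k * L - m * k)) *
        Real.sqrt (((2 * n : ℝ) ^ L) ^ (m' * k) / (2 * n : ℝ) ^ L) *
        Real.sqrt ((k * (m' * k) : ℕ) * (k * B)))) ≤
      Fintype.card (Fin (k + 1) → Fin m → Fin k → Fin n × Bool) * Real.exp (-(c₀ * n)) :=
    hscan.trans ((Nat.cast_le.2 hcard).trans (hN.trans_eq (mul_comm _ _)))
  -- the defect is at most `c₀ n / 4`
  have hcI : Q = (2 * n : ℝ) ^ (m * k) := by
    rw [hQ]
    simp only [Fintype.card_fun, Fintype.card_prod, Fintype.card_fin, Fintype.card_bool]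
    push_cast; ring
  have hcJ : (Fintype.card (Fin (m' * k * L - m * k) → Fin n × Bool) : ℝ) =
      (2 * n : ℝ) ^ (m' * k * L - m * k) := by
    simp only [Fintype.card_fun, Fintype.card_prod, Fintype.card_fin, Fintype.card_bool]
    push_cast; ring
  have hmk : m * k ≤ m' * k * L := by
    calc m * k ≤ m' * L * k := Nat.mul_le_mul_right k hmm'
      _ = m' * k * L := by ring
  have hV : ((2 * n : ℝ) ^ L) ^ (m' * k) = Q * (2 * n : ℝ) ^ (m' * k * L - m * k) := by
    rw [hcI, ← pow_mul, ← pow_add]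
    congr 1
    rw [Nat.add_sub_cancel' hmk]
    ring
  have hlog4n : Real.log (2 * (2 * n : ℝ) ^ L) ≤ 4 * L * Real.log n := by
    rw [Real.log_mul (by norm_num) (by positivity), Real.log_pow,
      Real.log_mul (by norm_num) (by positivity)]
    have h1 : (L : ℝ) * Real.log 2 ≤ L * Real.log n := mul_le_mul_of_nonneg_left hlogn hLrpos.le
    have h2 : Real.log 2 ≤ L * Real.log n := hlogn.trans (le_mul_of_one_le_left hlogpos.le hLr1)
    have h3 : 0 ≤ (L : ℝ) * Real.log n := by positivity
    linarith only [h1, h2, h3]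
  have hT : ((k * (m' * k) : ℕ) : ℝ) ≤ 2 * (k : ℝ) ^ 2 * α * n / L := by
    push_cast
    have h1 : (k : ℝ) * ((m' : ℝ) * k) ≤ k * ((m / L + 1) * k) :=
      mul_le_mul_of_nonneg_left (mul_le_mul_of_nonneg_right hm'le hkpos.le) hkpos.le
    have h2 : (m : ℝ) / L + 1 ≤ 2 * (α * n) / L := by
      rw [div_add_one hLrpos.ne', div_le_div_iff_of_pos_right hLrpos]
      linarith only [hmle, hLαn]
    have h3 : (k : ℝ) * ((m / L + 1) * k) ≤ k * ((2 * (α * n) / L) * k) :=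
      mul_le_mul_of_nonneg_left (mul_le_mul_of_nonneg_right h2 hkpos.le) hkpos.le
    have h4 : (k : ℝ) * ((2 * (α * n) / L) * k) = 2 * k ^ 2 * α * n / L := by ring
    linarith only [h1, h3, h4]
  have hE : 2 * Real.log (2 * (2 * n : ℝ) ^ L) / (S.card * (2 * n : ℝ) ^ (m' * k * L - m * k)) *
        Real.sqrt (((2 * n : ℝ) ^ L) ^ (m' * k) / (2 * n : ℝ) ^ L) *
        Real.sqrt ((k * (m' * k) : ℕ) * (k * B)) ≤ c₀ * n / 4 := by
    rw [hB, hcJ]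
    exact vld_defect_arith (NL := (2 * n : ℝ) ^ L) (Q := Q)
      (J := (2 * n : ℝ) ^ (m' * k * L - m * k)) (by positivity) hQpos
      (by positivity) hε hSbig.le hη₂0 hC hc₀ hnpos hlogpos hLr1 hk1r hα1 hV hlog4n (Nat.cast_nonneg _) hT
      (Nat.cast_nonneg _) hDn hθ
  -- the success factor is at least `ε^{T'+1}`
  have hp : ε ≤ (S.card : ℝ) / Q := by
    rw [le_div_iff₀ hQpos]; exact hSbig.le
  have hpow : ε ^ (k * (m' * k) + 1) ≤ ((S.card : ℝ) / Q) ^ (k * (m' * k) + 1) :=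
    pow_le_pow_left₀ hε.le hp _
  have hpow_eq : ε ^ (k * (m' * k) + 1) = Real.exp (-(lε * ((k * (m' * k) + 1 : ℕ) : ℝ))) := by
    have hεexp : Real.exp (-lε) = ε := by
      rw [hlε, one_div, Real.log_inv, neg_neg, Real.exp_log hε]
    rw [← hεexp, ← Real.exp_nat_mul]
    ring_nf
  -- compare exponents
  have hkey : Real.exp (-(lε * ((k * (m' * k) + 1 : ℕ) : ℝ))) * Real.exp (-(c₀ * n / 4)) ≤
      Real.exp (-(c₀ * n)) := by
    have h1 : (Fintype.card (Fin (k + 1) → Fin m → Fin k → Fin n × Bool) : ℝ) *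
        (Real.exp (-(lε * ((k * (m' * k) + 1 : ℕ) : ℝ))) * Real.exp (-(c₀ * n / 4))) ≤
        (Fintype.card (Fin (k + 1) → Fin m → Fin k → Fin n × Bool) : ℝ) *
          (((S.card : ℝ) / Q) ^ (k * (m' * k) + 1) *
            Real.exp (-(2 * Real.log (2 * (2 * n : ℝ) ^ L) /
                (S.card * (2 * n : ℝ) ^ (m' * k * L - m * k)) *
              Real.sqrt (((2 * n : ℝ) ^ L) ^ (m' * k) / (2 * n : ℝ) ^ L) *
              Real.sqrt ((k * (m' * k) : ℕ) * (k * B))))) := by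
      refine mul_le_mul_of_nonneg_left ?_ hPpos.le
      rw [← hpow_eq]
      exact mul_le_mul hpow (Real.exp_le_exp.2 (neg_le_neg hE)) (Real.exp_pos _).le
        (pow_nonneg (div_nonneg hScard_pos.le hQpos.le) _)
    rw [mul_assoc] at hchain
    exact le_of_mul_le_mul_left (h1.trans hchain) hPpos
  rw [← Real.exp_add, Real.exp_le_exp] at hkey
  -- the success exponent is at most `c₀ n / 2`
  have hT1 : lε * ((k * (m' * k) + 1 : ℕ) : ℝ) ≤ c₀ * n / 2 := by
    have hA : lε * ((k * (m' * k) : ℕ) : ℝ) ≤ lε * (2 * (k : ℝ) ^ 2 * α * n / L) :=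
      mul_le_mul_of_nonneg_left hT hlε0.le
    have hB' : lε * (2 * (k : ℝ) ^ 2 * α * n / L) ≤ c₀ * n / 4 := by
      rw [mul_div_assoc', div_le_iff₀ hLrpos]
      have h := mul_le_mul_of_nonneg_left hLge (by positivity : (0 : ℝ) ≤ c₀ * n / 4)
      have h' : c₀ * n / 4 * (8 * k ^ 2 * α * lε / c₀) = lε * (2 * k ^ 2 * α * n) := by
        field_simp
        ring
      linarith only [h, h']
    have hC' : lε ≤ c₀ * n / 4 := by
      have : lε ≤ ((k : ℝ) ^ 2 + 1) * lε := by
        have h0 := mul_nonneg (sq_nonneg (k : ℝ)) hlε0.le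
        linarith only [h0]
      exact this.trans hconst
    push_cast at hA ⊢
    linarith only [hA, hB', hC']
  have hc₀n : 0 < c₀ * n := by positivity
  linarith only [hkey, hT1, hc₀n]

end Summit.PneNP.PneNP.Theorems
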